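import Summits.CriticalPhenomena.PercolationContinuityZ3.Theorems.Transplant.KNCells2ThetaPosChosenO
import Summits.CriticalPhenomena.PercolationContinuityZ3.Theorems.Transplant.KNCells2ThetaPosChosen
import Summits.CriticalPhenomena.PercolationContinuityZ3.Theorems.Transplant.KNCellsSchemeO
import Summits.CriticalPhenomena.PercolationContinuityZ3.Theorems.Transplant.KNCellsProcessO
import Summits.CriticalPhenomena.PercolationContinuityZ3.Theorems.Transplant.KNCellsRunO
import Summits.CriticalPhenomena.PercolationContinuityZ3.Theorems.Transplant.KNCellsRunInvO
import Summits.CriticalPhenomena.PercolationContinuityZ3.Theorems.Transplant.KNCells2SchemeO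
import Summits.CriticalPhenomena.PercolationContinuityZ3.Theorems.Transplant.KNCells2RunO
import Summits.CriticalPhenomena.PercolationContinuityZ3.Theorems.Transplant.KNCells2RunInvO
import Summits.CriticalPhenomena.PercolationContinuityZ3.Theorems.Transplant.KNCellsCoverO
import Summits.CriticalPhenomena.PercolationContinuityZ3.Theorems.Transplant.KNCells2CoverO
import Summits.CriticalPhenomena.PercolationContinuityZ3.Theorems.Transplant.KNCellsReachO
import Summits.CriticalPhenomena.PercolationContinuityZ3.Theorems.Transplant.KNCells2ReachO
import Summits.CriticalPhenomena.PercolationContinuityZ3.Theorems.Transplant.KNCellsExitO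
import Summits.CriticalPhenomena.PercolationContinuityZ3.Theorems.Transplant.KNCells2ExitO
import Summits.CriticalPhenomena.PercolationContinuityZ3.Theorems.Transplant.KNCellsStepsDefsO
import Summits.CriticalPhenomena.PercolationContinuityZ3.Theorems.Transplant.KNCellsStepsChainO
import Summits.CriticalPhenomena.PercolationContinuityZ3.Theorems.Transplant.KNCellsStepsFailO
import Summits.CriticalPhenomena.PercolationContinuityZ3.Theorems.Transplant.KNCells2StepsO
import Summits.CriticalPhenomena.PercolationContinuityZ3.Theorems.Transplant.KNCells2FailO
import Summits.CriticalPhenomena.PercolationContinuityZ3.Theorems.Transplant.KNCells2FacePrefixO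
import Summits.CriticalPhenomena.PercolationContinuityZ3.Theorems.Transplant.KNCells2AnchorDepth
import Literature.Probability.Percolation.OrientedHistorySiteRenormalizationRun
import Summits.CriticalPhenomena.PercolationContinuityZ3.Theorems.Transplant.KNCells2AnchorNorm
import HarnessLib

/-!
# N2 (frames-only node `SamePDropOfSkeletonFrm₁`, OPEN) — ORIENTED MACRO LAYER (WAVE 0 (c1), (R-18) `q ≡ true`): the oriented twin of N1's `KNCells2AnchorDepth`

builds on p205010 (kernel theorem, internal audit signed; external expert review pending) — nothing in this file uses p205010; NOTHING is claimed about the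
open node `SamePDropOfSkeletonFrm₁` (`SamePDropOfSkeletonNeg₁` is CLOSED in the tree and untouched by this file).
Status sentence (coordinator 2026-08-20T04:30Z): "θ(p_c) = 0 on ℤ^d, all d ≥ 2 — kernel-verified (Lean 4/Mathlib, standard axioms); internal adversarial
audit SIGNED 2026-08-20 04:29Z; external expert review pending."
Lane `prim-bschramm-*`, seat `prim-bschramm-stmt` (gen 19); helper file (`--supports stmt-CriticalPhenomena-4575 --as helper`); N2-SCOPE §20, (R-18)/(R-19).
PORT RULES (HOME/prim-bschramm-stmt-g19/lean/port_orient.py): the history-site API is replaced by its ORIENTED twin at the fixed quadrant `qNE := fun _ => true`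
(`HState.choice ↦ HState.ochoice qNE`, `mstOf ↦ omstOf qNE`, `mst/stN ↦ omst/ostN qNE`, `occFinal ↦ ooccFinal qNE`, `Lawful ↦ OLawful qNE`, onward directions
`onward ↦ onwardO` = the POSITIVE ones, (N2-e)); every declaration whose text changes thereby — directly or through a changed declaration — is re-declared with the
suffix `O` (same namespace); unchanged declarations of the N1 file are NOT repeated (the N1 module is imported). Docstrings/citations are N1's.
N1 HEADER (kept for the reader):
* `anchors_of_choice_succ` — `β = α + 1`, or `e.1 = 0` with `α = β = 0`;
* `src_eq_step_of_dep_one` — if `β = 1` then the source is a lattice neighbour of the root: `e.1 = tgt (0, d)` for some `d`;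
* `zero_mem_occ_astOf₂`, `tgt_ne_zero_of_choice` — the root stays occupied, so a chosen target is never the root cell.
Hence at anchor `0` the three planar generations of the schedule are told apart by position exactly as `KNCellsBoxProdZ2ConcScheduleG`
assumes (`nQ 0 w = min ‖w‖₁ 2`): `(α,β) = (0,0)` ⇒ examined cell `= stepVec e.2` (generation 1); `(α,β) = (0,1)` ⇒ examined cell
`= stepVec d + stepVec e.2 ≠ 0` (generation 2); `α ≥ 1` ⇒ position-free.
[cite: KozmaNitzan2024, §4 pp. 25–27 (the exploration process; X_1 = G_1 = {0})]
-/
noncomputable section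

open scoped Classical

namespace Summit.CriticalPhenomena.PercolationContinuityZ3.Theorems

namespace Transplant

namespace KNCells

open Literature.Probability.Percolation Literature.Probability.LatticeModels SimpleGraph GadgetSystem ProbeHistory HSiteScheme Contour

namespace KSchA

variable {V : Type*} [DecidableEq V] {G : SimpleGraph V} [G.LocallyFinite] {S : KSchA V ℕ}

/-- **Unit-increment anchors are depths**: after any history every macro-vertex has `dep = arr + 1`, or both anchors `0` and it is occupied
only if it is the root. [folklore] -/
theorem anchors_replay_succO (hanch : ∀ a v P, S.Γ.anchor a v P = a + 1) (h0 : S.Γ.a₀ = 0) (h : ProbeHistory V) (v : Site 2) :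
    (S.astOf₂O G h).dep v = (S.astOf₂O G h).arr v + 1 ∨
      ((S.astOf₂O G h).arr v = 0 ∧ (S.astOf₂O G h).dep v = 0 ∧ (v ∈ (S.astOf₂O G h).st.occ → v = 0)) := by
  rcases anchors_replayO (S := S) (G := G) h v with ⟨P, hP⟩ | ⟨h1, h2, h3⟩
  · exact Or.inl (by rw [hP, hanch])
  · exact Or.inr ⟨by rw [h1, h0], by rw [h2, h0], h3⟩

/-- **Anchors of a chosen edge, unit-increment rule**: `β = α + 1`, or the source is the root with `α = β = 0`. [folklore] -/
theorem anchors_of_choice_succO (hanch : ∀ a v P, S.Γ.anchor a v P = a + 1) (h0 : S.Γ.a₀ = 0) (h : ProbeHistory V)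
    {e : Site 2 × MDir} (hc : (S.astOf₂O G h).st.ochoice qNE = some e) :
    S.aOf₂O G h e = S.aOf₁O G h e + 1 ∨ (e.1 = 0 ∧ S.aOf₁O G h e = 0 ∧ S.aOf₂O G h e = 0) := by
  rcases anchors_replay_succO (S := S) (G := G) hanch h0 h e.1 with h1 | ⟨h1, h2, h3⟩
  · exact Or.inl h1
  · exact Or.inr ⟨h3 (HState.cand_of_ochoice hc).1, h1, h2⟩

/-- **The root stays occupied** along the replay of any history. [cite: KozmaNitzan2024, §4 p. 25 (G_1 = {0})] -/
theorem zero_mem_occ_astOf₂O : ∀ h : ProbeHistory V, (0 : Site 2) ∈ (S.astOf₂O G h).st.occ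
  | [] => by simp [astOf₂_nilO, HState.start]
  | none :: h => by rw [astOf₂_cons_noneO]; exact zero_mem_occ_astOf₂O h
  | some r :: h => by
    rw [astOf₂_cons_someO]
    cases hc : (S.astOf₂O G h).st.ochoice qNE with
    | none => exact zero_mem_occ_astOf₂O h
    | some e =>
      dsimp only
      exact HState.occ_subset_update _ _ _ (zero_mem_occ_astOf₂O h)

/-- **A chosen target is never the root cell** (the root is occupied, hence determined, and candidates have undetermined targets). [folklore] -/
theorem tgt_ne_zero_of_choiceO (h : ProbeHistory V) {e : Site 2 × MDir} (hc : (S.astOf₂O G h).st.ochoice qNE = some e) : tgt e ≠ 0 := by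
  intro ht
  have hdet : (S.astOf₂O G h).st.Det (tgt e) := by rw [ht]; exact Or.inl (zero_mem_occ_astOf₂O (S := S) (G := G) h)
  exact (HState.cand_of_ochoice hc).2 hdet

/-- **Depth-one vertices are lattice neighbours of the root** (unit-increment rule): if `dep v = 1` after some history then `v = tgt (0, d)` for
some direction `d` — because `v` was a target examined from a source of depth `0`, and the only occupied vertex of depth `0` is the root. [folklore] -/
theorem eq_step_of_dep_oneO (hanch : ∀ a v P, S.Γ.anchor a v P = a + 1) (h0 : S.Γ.a₀ = 0) :
    ∀ (h : ProbeHistory V) (v : Site 2), (S.astOf₂O G h).dep v = 1 → ∃ d : MDir, v = tgt ((0 : Site 2), d)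
  | [], v, hv => by
    exfalso
    have : (S.astOf₂O G []).dep v = 0 := by simp [astOf₂_nilO, h0]
    omega
  | none :: h, v, hv => by
    rw [astOf₂_cons_noneO] at hv
    exact eq_step_of_dep_oneO hanch h0 h v hv
  | some r :: h, v, hv => by
    rw [astOf₂_cons_someO] at hv
    cases hc : (S.astOf₂O G h).st.ochoice qNE with
    | none =>
      rw [hc] at hv
      exact eq_step_of_dep_oneO hanch h0 h v hv
    | some e =>
      rw [hc] at hv
      dsimp only at hv
      by_cases hve : v = tgt e
      · subst hve
        simp only [Function.update_self, depB, hanch] at hv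
        -- the source has depth 0, and it is occupied: it is the root
        have hdep0 : (S.astOf₂O G h).dep e.1 = 0 := by omega
        have he0 : e.1 = 0 := by
          rcases anchors_replay_succO (S := S) (G := G) hanch h0 h e.1 with h1 | ⟨-, -, h3⟩
          · omega
          · exact h3 (HState.cand_of_ochoice hc).1
        refine ⟨e.2, ?_⟩
        obtain ⟨e1, e2⟩ := e
        simp only at he0
        subst he0
        rfl
      · rw [Function.update_of_ne hve] at hv
        exact eq_step_of_dep_oneO hanch h0 h v hv

/-- **Source of a chosen edge with stub anchor `1`** is a lattice neighbour of the root (so the examined cell `tgt e = tgt (0,d) + stepVec e.2`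
is a planar generation-`2` cell, being `≠ 0` by `tgt_ne_zero_of_choiceO`). [folklore] -/
theorem src_eq_step_of_choice_dep_oneO (hanch : ∀ a v P, S.Γ.anchor a v P = a + 1) (h0 : S.Γ.a₀ = 0) (h : ProbeHistory V)
    {e : Site 2 × MDir} (h1 : S.aOf₂O G h e = 1) : ∃ d : MDir, e.1 = tgt ((0 : Site 2), d) :=
  eq_step_of_dep_oneO hanch h0 h e.1 h1

/-- **Source of a chosen edge with stub anchor `0`** is the root (so the examined cell is `tgt (0, e.2) = stepVec e.2`, generation `1`). [folklore] -/
theorem src_eq_zero_of_choice_dep_zeroO (hanch : ∀ a v P, S.Γ.anchor a v P = a + 1) (h0 : S.Γ.a₀ = 0) (h : ProbeHistory V)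
    {e : Site 2 × MDir} (hc : (S.astOf₂O G h).st.ochoice qNE = some e) (hβ : S.aOf₂O G h e = 0) : e.1 = 0 := by
  rcases anchors_of_choice_succO (S := S) (G := G) hanch h0 h hc with h1 | ⟨h1, -, -⟩
  · rw [hβ] at h1; omega
  · exact h1

end KSchA

end KNCells

end Transplant

end Summit.CriticalPhenomena.PercolationContinuityZ3.Theorems

end

/-! ## (merged module) the oriented twin `KNCells2AnchorNormO` — same port rules, header as in part 1 -/
noncomputable section

open scoped Classical

namespace Summit.CriticalPhenomena.PercolationContinuityZ3.Theorems

namespace Transplant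

namespace KNCells

open Literature.Probability.Percolation Literature.Probability.LatticeModels SimpleGraph GadgetSystem ProbeHistory HSiteScheme
open Literature.Probability.Percolation.KozmaNitzan.Cells (oth oth_ne sgOf sgOf_sign stepVec_apply_fst stepVec_apply_oth eq_oth_of_ne oth_oth)

namespace KSchA

variable {V : Type*} [DecidableEq V] {G : SimpleGraph V} [G.LocallyFinite] {S : KSchA V ℕ}

/-- **Replay invariant: anchors dominate the planar position** (unit-increment rule, root anchor `0`): after any history every macro-vertex `v`
either carries the anchors `(0, 0)` and is occupied only if `v = 0`, or satisfies `‖v‖₁ ≤ dep v` and `‖v‖₁ ≤ arr v + 1` (a target examined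
from an occupied source `u` gets `arr := dep u ≥ ‖u‖₁ ≥ ‖v‖₁ − 1` and `dep := dep u + 1`). [folklore] -/
theorem norm_le_anchorsO (hanch : ∀ a v P, S.Γ.anchor a v P = a + 1) (h0 : S.Γ.a₀ = 0) :
    ∀ (h : ProbeHistory V) (v : Site 2),
      ((S.astOf₂O G h).arr v = 0 ∧ (S.astOf₂O G h).dep v = 0 ∧ (v ∈ (S.astOf₂O G h).st.occ → v = 0)) ∨
        (l1 v ≤ (S.astOf₂O G h).dep v ∧ l1 v ≤ (S.astOf₂O G h).arr v + 1)
  | [], v => by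
    left
    refine ⟨by simp [astOf₂_nilO, h0], by simp [astOf₂_nilO, h0], fun hv => ?_⟩
    simpa [astOf₂_nilO, HState.start] using hv
  | none :: h, v => by
    rw [astOf₂_cons_noneO]; exact norm_le_anchorsO hanch h0 h v
  | some r :: h, v => by
    rw [astOf₂_cons_someO]
    cases hc : (S.astOf₂O G h).st.ochoice qNE with
    | none => exact norm_le_anchorsO hanch h0 h v
    | some e =>
      dsimp only
      by_cases hve : v = tgt e
      · subst hve
        right
        simp only [Function.update_self, depB, hanch]
        -- the source is occupied; apply the invariant to it
        have hocc : e.1 ∈ (S.astOf₂O G h).st.occ := (HState.cand_of_ochoice hc).1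
        have hstep := l1_tgt_le e
        rcases norm_le_anchorsO hanch h0 h e.1 with ⟨h1, h2, h3⟩ | ⟨h1, h2⟩
        · have he0 : e.1 = 0 := h3 hocc
          rw [he0, l1_zero] at hstep
          rw [h2]; omega
        · omega
      · rcases norm_le_anchorsO hanch h0 h v with ⟨h1, h2, h3⟩ | ⟨h1, h2⟩
        · left
          refine ⟨by rw [Function.update_of_ne hve]; exact h1, by rw [Function.update_of_ne hve]; exact h2, fun hocc => ?_⟩
          rcases Finset.mem_insert.1 (HState.occ_update_subset _ _ _ hocc) with h' | h'
          · exact absurd h' hve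
          · exact h3 h'
        · right
          exact ⟨by rw [Function.update_of_ne hve]; exact h1, by rw [Function.update_of_ne hve]; exact h2⟩

/-- An occupied macro-vertex satisfies `‖v‖₁ ≤ dep v`. [folklore] -/
theorem norm_le_dep_of_occO (hanch : ∀ a v P, S.Γ.anchor a v P = a + 1) (h0 : S.Γ.a₀ = 0) (h : ProbeHistory V) {v : Site 2}
    (hv : v ∈ (S.astOf₂O G h).st.occ) : l1 v ≤ (S.astOf₂O G h).dep v := by
  rcases norm_le_anchorsO (S := S) (G := G) hanch h0 h v with ⟨-, -, h3⟩ | ⟨h1, -⟩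
  · rw [h3 hv, l1_zero]; exact Nat.zero_le _
  · exact h1

/-- An occupied macro-vertex satisfies `‖v‖₁ ≤ arr v + 1`. [folklore] -/
theorem norm_le_arr_succ_of_occO (hanch : ∀ a v P, S.Γ.anchor a v P = a + 1) (h0 : S.Γ.a₀ = 0) (h : ProbeHistory V) {v : Site 2}
    (hv : v ∈ (S.astOf₂O G h).st.occ) : l1 v ≤ (S.astOf₂O G h).arr v + 1 := by
  rcases norm_le_anchorsO (S := S) (G := G) hanch h0 h v with ⟨-, -, h3⟩ | ⟨-, h2⟩
  · rw [h3 hv, l1_zero]; exact Nat.zero_le _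
  · exact h2

/-- **At a chosen edge the examined cell lies within `aOf₁O + 2` of the macro-origin**: `‖tgt e‖₁ ≤ α + 2` (`α = arr e.1`, the arrival anchor of
the occupied source). [folklore] -/
theorem norm_tgt_le_aOf₁_add_twoO (hanch : ∀ a v P, S.Γ.anchor a v P = a + 1) (h0 : S.Γ.a₀ = 0) (h : ProbeHistory V)
    {e : Site 2 × MDir} (hc : (S.astOf₂O G h).st.ochoice qNE = some e) : l1 (tgt e) ≤ S.aOf₁O G h e + 2 := by
  have := norm_le_arr_succ_of_occO (S := S) (G := G) hanch h0 h (HState.cand_of_ochoice hc).1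
  have := l1_tgt_le e
  change l1 (tgt e) ≤ (S.astOf₂O G h).arr e.1 + 2
  omega

/-- **… and within `aOf₂O + 1`**: `‖tgt e‖₁ ≤ β + 1` (`β = dep e.1`, the stub anchor). [folklore] -/
theorem norm_tgt_le_aOf₂_succO (hanch : ∀ a v P, S.Γ.anchor a v P = a + 1) (h0 : S.Γ.a₀ = 0) (h : ProbeHistory V)
    {e : Site 2 × MDir} (hc : (S.astOf₂O G h).st.ochoice qNE = some e) : l1 (tgt e) ≤ S.aOf₂O G h e + 1 := by
  have := norm_le_dep_of_occO (S := S) (G := G) hanch h0 h (HState.cand_of_ochoice hc).1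
  have := l1_tgt_le e
  change l1 (tgt e) ≤ (S.astOf₂O G h).dep e.1 + 1
  omega

/-- The source of a chosen edge satisfies `‖e.1‖₁ ≤ aOf₁O + 1`. [folklore] -/
theorem norm_src_le_aOf₁_succO (hanch : ∀ a v P, S.Γ.anchor a v P = a + 1) (h0 : S.Γ.a₀ = 0) (h : ProbeHistory V)
    {e : Site 2 × MDir} (hc : (S.astOf₂O G h).st.ochoice qNE = some e) : l1 e.1 ≤ S.aOf₁O G h e + 1 :=
  norm_le_arr_succ_of_occO hanch h0 h (HState.cand_of_ochoice hc).1

end KSchA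

end KNCells

end Transplant

end Summit.CriticalPhenomena.PercolationContinuityZ3.Theorems

end
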